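import Summits.CriticalPhenomena.CardyFormulaZ2.Theorems.CardyComplexConeParafermionToSLESixFamiliesDiamondDefsR6
import Summits.CriticalPhenomena.CardyFormulaZ2.Theorems.CardyComplexConeParafermionToSLESixFamiliesIicRectilinear
import HarnessLib

/-!
# Crux `ParafermionToSLESixFamilies` (stmt-CriticalPhenomena-11389) BY NAME from the named inputs of line `potential-darboux-picard-diamond`

Lead c5, end of cycle 1 (2026-08-17). The line has PROVED its lattice side S1 (exact potential + phase-anchored boundary trace), its engine S2
(Darboux–Picard) and S4′ (Arzelà–Ascoli, limit polygon, conformal identification), and the CONDITIONAL derivation of the guarded collar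
statement S3′ from three inputs external to the crux (`potentialConformalLimit_of_inputs`, `…DiamondDefsR6.lean`, p168985). This file records
the resulting reduction of the crux itself, kernel-checked and by name: the route declaration
`Summit.CriticalPhenomena.CardyFormulaZ2.Theses.CardyComplexCone.ParafermionToSLESixFamilies` follows from

* X1 `EdgePrecompact.QkzStripBoundaryArm.UniformInnerEnvelope` (11387's milestone: the mesoscopic inner envelope of the corner observable),
* route item #2 `CardyComplexCone.EdgeCoherence` (stmt-CriticalPhenomena-11385),
* N `FlipInvolutionReturnLaw.DiagHalfPlaneOneArmLower` (⇐ `Literature.Probability.Percolation.IkhlefPonsaingFirstPassage`, p134439),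
* U = S5 `PotentialConformalLimit → ∀ D, IsDiagRectilinear D → DiagTouchLawPosPin D` (slit-uniform pinned diagonal touch law — research),
* S6 `(∀ D, IsDiagRectilinear D → DiagTouchLawPosPin D) → IdentOnDiagRectilinear` (⇐ PercFaceBoxTight + window-density transport + boundary
  κ = 6 detector + SLE₆ reversibility, `identOnDiagRectilinear_of_boxTight_of_paraApprox` p138957),
* S7 `(∀ D, IsDiagRectilinear D → ∀ Λ, IsFamily D Λ → SLESixAlong D Λ) → SLESixAllFamilies` (⇐ PIECE 1 + PIECE 3, `allDomainsOfDiag_of` p134764),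

and the crux's own hypotheses A (`WeakHolFamilies`) and B (`PrecompactFamilies`) are NOT used (consistent with `Disproof.lean` §5). Registered
helper of the crux item; nothing else is declared.
-/

noncomputable section

namespace Summit.CriticalPhenomena.CardyFormulaZ2.Cruxes.ParafermionToSLESixFamilies.PotentialDarbouxPicardDiamond

open Literature.Probability Literature.Probability.LatticeModels Literature.Probability.Percolation
open Literature.Probability.RandomPlanarGeometry
open Summit.CriticalPhenomena.CardyFormulaZ2.Theses.CardyComplexCone (ParafermionToSLESixFamilies)
open Summit.CriticalPhenomena.CardyFormulaZ2.Cruxes.ParafermionToSLESixFamilies.IicTraceFluxPairing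
open Summit.CriticalPhenomena.CardyFormulaZ2.Cruxes.ParafermionToSLESixFamilies.FlipInvolutionReturnLaw
  (IsDiagRectilinear IdentOnDiagRectilinear)

/-- **The crux by name from the line's named inputs** (X1, #2, N, U = S5, S6, S7): `WeakHolFamilies → PrecompactFamilies → SLESixAllFamilies`
unfolded definitionally; A and B unused. -/
theorem parafermionToSLESixFamilies_of_lineInputs :
    Summit.CriticalPhenomena.CardyFormulaZ2.Cruxes.EdgePrecompact.QkzStripBoundaryArm.UniformInnerEnvelope →
    Summit.CriticalPhenomena.CardyFormulaZ2.Theses.CardyComplexCone.EdgeCoherence →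
    Summit.CriticalPhenomena.CardyFormulaZ2.Cruxes.ParafermionToSLESixFamilies.FlipInvolutionReturnLaw.DiagHalfPlaneOneArmLower →
    (PotentialConformalLimit → ∀ D : DobrushinDomain, IsDiagRectilinear D → DiagTouchLawPosPin D) →
    ((∀ D : DobrushinDomain, IsDiagRectilinear D → DiagTouchLawPosPin D) → IdentOnDiagRectilinear) →
    ((∀ D : DobrushinDomain, IsDiagRectilinear D → ∀ Λ : ℝ → DiscreteDobrushin, IsFamily D Λ → SLESixAlong D Λ) → SLESixAllFamilies) →
    ParafermionToSLESixFamilies :=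
  fun hX hE hN h₅ h₆ h₇ _ _ =>
    h₇ fun D hD Λ hΛ => slesixAlong_of_ident D Λ hΛ (h₆ (h₅ (potentialConformalLimit_of_inputs hX hE hN)) D hD Λ hΛ)

end Summit.CriticalPhenomena.CardyFormulaZ2.Cruxes.ParafermionToSLESixFamilies.PotentialDarbouxPicardDiamond

end
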